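import Summits.CriticalPhenomena.PercolationContinuityZ3.Theorems.PercNearOneGluingNoHeavyLowerTailSunflowerTBernT2LevCore
import HarnessLib

/-!
# `NoHeavyLowerTail` (crux stmt-CriticalPhenomena-4575), abstract sunflower cubic: T-BERN — the certificate for
# {hub, sub-dwarf pack, ONE LEVERAGED TIGHT PETAL} families (the leveraged petal absorbed last)

Support file (seat `prim-ineq-prove-1` gen 65; `--supports stmt-CriticalPhenomena-4575`).  No `sorry`, no named facts.
Memo: run/shared/lean/prim/prim-ineq-prove-1/FINDING-REDUCTION-prove1-g65.md §2.

**`domOn_hub_pack_lev`**: the `TBern` certificate `DomOn s b β V` for every admissible family {arbitrary petal `P`, sub-dwarf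
pack `Q` (`vv = β`, `m = u`; floors included), tight petal `r` (`m_r = u_r`) with `β·m_r ≤ b·vv_r`} (`0 < b ≤ β ≤ 1`, `0 ≤ s ≤ 1`).
The proof is the sequential scheme: hub singleton, flexible exact absorption of the pack (`zone_extend_flex`), and the last step
★ᵣ supplied by `star_r_of_hcr` + `hcr_of_hc` (`…SunflowerTBernT2LevCore`) from `hc_pack`; the dictionary model → normalised
coordinates is the one of `…SunflowerTBernHubPackH`.  This contains `domOn_hub_pack_h` (the case `u_r = m_r = b`) and is one of
the two endgames of the reduction of `TBern` to irreducible floor-free families (memo §1): there the last petal is the unique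
tight petal with `vv > β` that is an h-petal or a leveraged "T2" petal.
-/

noncomputable section

namespace Summit.CriticalPhenomena.PercolationContinuityZ3.Theorems.SunflowerPartition

namespace SafeCalc

namespace LinkedCurrency

open Finset Polynomial

variable {ι : Type*}

/-! ## The certificate for {hub, sub-dwarf pack, leveraged tight petal} families -/

/-- **The `TBern` certificate for every admissible {hub, sub-dwarf pack, leveraged tight petal} family.**  Parameters
`0 < b ≤ β ≤ 1`, `0 ≤ s ≤ 1`; the family on `insert r (insert P Q)` is admissible (`AdmissibleOn`), the pack petals
`j ∈ Q` have `vv_j = β`, `m_j = u_j` (sub-dwarfs and floors), the last petal `r` is tight (`m_r = u_r`) and leveraged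
(`β·m_r ≤ b·vv_r`; e.g. an h-petal `u_r = m_r = b`); `P` is arbitrary.  Then `DomOn s b β V (insert r (insert P Q)) u vv m`.
[this work] -/
theorem domOn_hub_pack_lev [DecidableEq ι] {s b β V : ℝ} (hb : 0 < b) (hbβ : b ≤ β) (hβ1 : β ≤ 1) (hs0 : 0 ≤ s)
    (hs1 : s ≤ 1) {Q : Finset ι} {P r : ι} (hPQ : P ∉ Q) (hrQ : r ∉ Q) (hrP : r ≠ P) {u vv m : ι → ℝ}
    (hadm : AdmissibleOn s b β V (insert r (insert P Q)) u vv m)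
    (hpack : ∀ j ∈ Q, vv j = β ∧ m j = u j) (hr : m r = u r) (hlev : β * m r ≤ b * vv r) :
    DomOn s b β V (insert r (insert P Q)) u vv m := by
  obtain ⟨hub, -, hvβ, -, hmb, hmu, hmv, hpu, hpv, hpg⟩ := hadm
  have hs' : 0 ≤ 1 - s := sub_nonneg.2 hs1
  have hβ : 0 < β := hb.trans_le hbβ
  have hA₀ : 0 < s + (1 - s) * b := by
    have : 0 ≤ s * (1 - b) := mul_nonneg hs0 (by linarith)
    nlinarith
  have ha₀ : 0 < (1 - s) * b + s * β := by
    have : 0 ≤ s * (β - b) := mul_nonneg hs0 (sub_nonneg.2 hbβ)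
    nlinarith
  have hA₀ne := hA₀.ne'
  have ha₀ne := ha₀.ne'
  have hbne := hb.ne'
  have hβne := hβ.ne'
  -- membership facts
  have hrt : r ∉ insert P Q := by rw [mem_insert, not_or]; exact ⟨hrP, hrQ⟩
  have hP : P ∈ insert r (insert P Q) := mem_insert_of_mem (mem_insert_self P Q)
  have hrr : r ∈ insert r (insert P Q) := mem_insert_self r _
  have hQ : ∀ j ∈ Q, j ∈ insert r (insert P Q) := fun j hj => mem_insert_of_mem (mem_insert_of_mem hj)
  have hcard : (insert r (insert P Q)).card = Q.card + 2 := by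
    rw [card_insert_of_notMem hrt, card_insert_of_notMem hPQ]
  rw [hcard, show Q.card + 2 - 1 = Q.card + 1 by omega] at hpu hpv hpg
  rw [prod_insert hrt, prod_insert hPQ] at hpu hpv hpg
  -- normalised parameters
  set A₀ := s + (1 - s) * b with hA₀d
  set a₀ := (1 - s) * b + s * β with ha₀d
  set κ := (1 - s) * b / A₀ with hκ
  set lam := (1 - s) * b / a₀ with hlam
  set μ := s * β / a₀ with hμd
  set D := β / b with hDd
  set K := (1 - s) / A₀ with hKd
  have hκ0 : 0 ≤ κ := div_nonneg (mul_nonneg hs' hb.le) hA₀.le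
  have hκl : κ ≤ lam := by
    rw [hκ, hlam]
    refine div_le_div_of_nonneg_left (mul_nonneg hs' hb.le) ha₀ ?_
    rw [ha₀d, hA₀d]; linarith [mul_le_mul_of_nonneg_left hβ1 hs0]
  have hl1 : lam ≤ 1 := by rw [hlam, div_le_one ha₀, ha₀d]; linarith [mul_nonneg hs0 hβ.le]
  have hl0 : 0 ≤ lam := hκ0.trans hκl
  have hκ1 : κ ≤ 1 := hκl.trans hl1
  have hμ : μ = 1 - lam := norm_mu_eq ha₀ne
  have hμ0 : 0 ≤ μ := div_nonneg (mul_nonneg hs0 hβ.le) ha₀.le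
  have hlμ : lam + μ = 1 := by rw [hμ]; ring
  have hD : 1 ≤ D := by rw [hDd, one_le_div hb]; exact hbβ
  have hK0 : 0 ≤ K := div_nonneg hs' hA₀.le
  have habar : 1 / A₀ = (1 - κ) + K := norm_abar_eq hA₀ne
  have hγD : lam * D + μ = β / a₀ := norm_gammaD_eq hbne ha₀ne
  have hI : μ * (1 / A₀) = (1 - κ) * (lam * D + μ) := by rw [hγD]; exact norm_I_eq hA₀ne ha₀ne
  have hγD0 : 0 < lam * D + μ := by rw [hγD]; exact div_pos hβ ha₀
  have hγD1 : 1 ≤ lam * D + μ := by rw [hμ]; linarith [mul_le_mul_of_nonneg_left hD hl0]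
  -- normalised functions
  set xf : ι → ℝ := fun j => u j / b with hxf
  set cf : ι → ℝ := fun j => ((1 - s) * m j + s * vv j) / a₀ with hcf
  set ξ : ι → ℝ := fun j => u j / b - 1 with hξ
  have hα : ∀ j, (s + (1 - s) * u j) / A₀ = 1 + κ * (xf j - 1) := fun j => norm_alpha_eq hbne hA₀ne
  have hcf_eq : ∀ j, cf j = lam * (m j / b) + μ * (vv j / β) := fun j => norm_gamma_eq hbne hβne ha₀ne
  have hxξ : ∀ j, xf j = 1 + ξ j := fun j => by simp only [hxf, hξ]; ring
  -- pack data
  have hξ0 : ∀ j ∈ Q, 0 ≤ ξ j := fun j hj => by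
    have h1 : 1 ≤ u j / b := by rw [one_le_div hb]; exact hub j (hQ j hj)
    simp only [hξ]; linarith
  have hξD : ∀ j ∈ Q, ξ j ≤ D - 1 := fun j hj => by
    have h1 : u j ≤ β := by rw [← (hpack j hj).2, ← (hpack j hj).1]; exact hmv j (hQ j hj)
    have h2 : u j / b ≤ β / b := div_le_div_of_nonneg_right h1 hb.le
    simp only [hξ, hDd]; linarith
  have hcfQ : ∀ j ∈ Q, cf j = 1 + lam * ξ j := fun j hj => by
    rw [hcf_eq, (hpack j hj).2, (hpack j hj).1, div_self hβne, hμ]; simp only [hξ]; ring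
  -- hub data
  have hxP1 : 1 ≤ u P / b := by rw [one_le_div hb]; exact hub P hP
  have hz1 : 1 ≤ vv P / β := by rw [one_le_div hβ]; exact hvβ P hP
  have hw1 : 1 ≤ m P / b := by rw [one_le_div hb]; exact hmb P hP
  have hwx : m P / b ≤ u P / b := div_le_div_of_nonneg_right (hmu P hP) hb.le
  have hwD : m P / b ≤ D * (vv P / β) := by
    rw [hDd, div_mul_div_comm, div_le_div_iff₀ hb (mul_pos hb hβ)]
    have := mul_le_mul_of_nonneg_right (hmv P hP) (mul_pos hb hβ).le
    linarith
  have hγP : cf P = lam * (m P / b) + μ * (vv P / β) := hcf_eq P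
  have hγP1 : 1 ≤ cf P := by
    have h1 : lam * 1 ≤ lam * (m P / b) := mul_le_mul_of_nonneg_left hw1 hl0
    have h2 : μ * 1 ≤ μ * (vv P / β) := mul_le_mul_of_nonneg_left hz1 hμ0
    rw [hγP]; rw [hμ] at h2 ⊢; linarith
  have hγP0 : 0 < cf P := by linarith
  -- last-petal data: `w = m_r/b = x_r`, `z = vv_r/β ≥ w`
  set w := m r / b with hwdef
  set z := vv r / β with hzdef
  have hw : 1 ≤ w := by rw [hwdef, one_le_div hb]; exact hmb r hrr
  have hwz : w ≤ z := by
    rw [hwdef, hzdef, div_le_div_iff₀ hb hβ]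
    linarith
  have hxr : xf r = w := by simp only [hxf, hwdef, hr]
  have har : 1 + κ * (xf r - 1) = 1 + κ * (w - 1) := by rw [hxr]
  have hcr : cf r = lam * w + μ * z := by rw [hcf_eq]
  have hαr0 : 0 ≤ 1 + κ * (w - 1) := by have := mul_nonneg hκ0 (sub_nonneg.2 hw); linarith
  have hαγr : 1 + κ * (w - 1) ≤ lam * w + μ * z := by
    have h1 := alpha_le_gamma hκl hw
    have h2 : μ * w ≤ μ * z := mul_le_mul_of_nonneg_left hwz hμ0
    have h3 := mul_nonneg hμ0 (sub_nonneg.2 hw)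
    rw [hμ] at h2 h3 ⊢; linarith
  have hcr0 : 0 ≤ cf r := by rw [hcr]; exact hαr0.trans hαγr
  -- STEP A: hub singleton + flexible absorption of the pack
  have hbase : CoefDom (prodPoly {P} (fun j => 1 + κ * (xf j - 1)) cf)
      ((C 1 * X + C 1) ^ (({P} : Finset ι).card - 1) * (C (1 + κ * (u P / b - 1)) * X + C (cf P))) :=
    coefDom_prodPoly_singleton le_rfl le_rfl
  have hαP0 : 0 ≤ 1 + κ * (u P / b - 1) := by
    have := mul_nonneg hκ0 (sub_nonneg.2 hxP1); linarith
  have hQx : ∀ j ∈ Q, 1 ≤ xf j := fun j hj => by rw [hxξ]; linarith [hξ0 j hj]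
  have hQγx : ∀ j ∈ Q, cf j ≤ xf j := fun j hj => by
    rw [hcfQ j hj, hxξ]
    have := mul_le_mul_of_nonneg_right hl1 (hξ0 j hj)
    linarith
  have hQg : ∀ j ∈ Q, 1 + κ * (xf j - 1) ≤ cf j := fun j hj => by
    rw [hcfQ j hj, hxξ, add_sub_cancel_left]
    have := mul_le_mul_of_nonneg_right hκl (hξ0 j hj)
    linarith
  obtain ⟨A', hdomPQ, hA'le, hA'0, hdisj⟩ := zone_extend_flex (X₀ := u P / b) (A := 1 + κ * (u P / b - 1))
    (G := cf P) hκ0 hκ1 xf cf {P} (singleton_nonempty P) hxP1 hγP1 le_rfl hαP0 hbase Q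
    (disjoint_singleton_left.2 hPQ) hQx hQγx hQg
  rw [← insert_eq] at hdomPQ
  -- the pack quantities of `…SunflowerTBernPackStep`
  have hpackG : packG lam Q ξ = ∏ j ∈ Q, cf j := prod_congr rfl fun j hj => (hcfQ j hj).symm
  have hpackS : packS κ lam Q ξ = ∑ j ∈ Q, (cf j - (1 + κ * (xf j - 1))) / cf j := by
    refine sum_congr rfl fun j hj => ?_
    rw [hcfQ j hj, hxξ, add_sub_cancel_left]; ring
  have hprodX : ∏ j ∈ Q, (1 + ξ j) = ∏ j ∈ Q, xf j := prod_congr rfl fun j _ => (hxξ j).symm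
  have hXQ1 : 1 ≤ ∏ j ∈ Q, xf j := Pendant.one_le_prod_of_one_le Q hQx
  have hGQ1 : 1 ≤ cf P * ∏ j ∈ Q, cf j := by
    have : 1 ≤ ∏ j ∈ Q, cf j := by rw [← hpackG]; exact one_le_packG hl0 Q hξ0
    exact one_le_mul_of_one_le_of_one_le hγP1 this
  have hGQ0 : 0 ≤ cf P * ∏ j ∈ Q, cf j := zero_le_one.trans hGQ1
  -- BUDGETS.  u-budget ⟹ u_r u_P ∏_Q u_j ≤ b^(|Q|+1) ⟹ κ (x_P w) ∏(1+ξ_j) ≤ K and x_P w ∏ x_j ≤ 1/b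
  have hXprod : u P / b * w * ∏ j ∈ Q, xf j = (u r * (u P * ∏ j ∈ Q, u j)) / (b * b * b ^ Q.card) := by
    simp only [hxf]
    rw [hwdef, hr, prod_div_distrib, prod_const, div_mul_div_comm, div_mul_div_comm]
    ring
  have hXle : u P / b * w * ∏ j ∈ Q, xf j ≤ 1 / b := by
    rw [hXprod, div_le_div_iff₀ (mul_pos (mul_pos hb hb) (pow_pos hb _)) hb]
    calc (u r * (u P * ∏ j ∈ Q, u j)) * b ≤ b ^ (Q.card + 1) * b := mul_le_mul_of_nonneg_right hpu hb.le
      _ = 1 * (b * b * b ^ Q.card) := by ring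
  have hbud : κ * (u P / b * w) * ∏ j ∈ Q, (1 + ξ j) ≤ K := by
    rw [hprodX, mul_assoc, hκ, hKd, div_mul_eq_mul_div, div_le_div_iff_of_pos_right hA₀]
    have h1 := mul_le_mul_of_nonneg_left (show u P / b * w * ∏ j ∈ Q, xf j ≤ 1 / b by exact hXle)
      (mul_nonneg hs' hb.le)
    have e : (1 - s) * b * (1 / b) = 1 - s := by field_simp
    have e2 : u P / b * w * ∏ j ∈ Q, xf j = u P / b * (w * ∏ j ∈ Q, xf j) := by ring
    rw [← mul_assoc]; rw [e2] at h1; linarith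
  -- α(x_P X_Q w) ≤ 1/A₀
  have hαbud : 1 + κ * (u P / b * (∏ j ∈ Q, xf j) * w - 1) ≤ 1 / A₀ := by
    rw [habar, hKd, hκ]
    have h1 : (1 - s) * b / A₀ * (u P / b * (∏ j ∈ Q, xf j) * w - 1) ≤ (1 - s) * b / A₀ * (1 / b - 1) :=
      mul_le_mul_of_nonneg_left (by linarith [hXle]) hκ0
    have e : (1 - s) * b / A₀ * (1 / b - 1) = (1 - s) / A₀ - (1 - s) * b / A₀ := by field_simp
    linarith
  have hX₁1 : 1 ≤ u P / b * ∏ j ∈ Q, xf j := one_le_mul_of_one_le_of_one_le hxP1 hXQ1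
  have hA'abar : A' ≤ 1 / A₀ := by
    refine hA'le.trans (le_trans ?_ hαbud)
    have : u P / b * ∏ j ∈ Q, xf j ≤ u P / b * (∏ j ∈ Q, xf j) * w :=
      le_mul_of_one_le_right (by linarith) hw
    linarith [mul_le_mul_of_nonneg_left this hκ0]
  have hA'a : A' * (1 + κ * (w - 1)) ≤ 1 / A₀ := by
    have h1 : A' * (1 + κ * (w - 1)) ≤ (1 + κ * (u P / b * ∏ j ∈ Q, xf j - 1)) * (1 + κ * (w - 1)) :=
      mul_le_mul_of_nonneg_right hA'le hαr0
    exact h1.trans ((alpha_mul_le hκ0 hκ1 hX₁1 hw).trans hαbud)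
  have hA'w : A' * w ≤ 1 / A₀ + (1 - κ) * (w - 1) := by
    have h1 : A' * w ≤ (1 + κ * (u P / b * ∏ j ∈ Q, xf j - 1)) * w :=
      mul_le_mul_of_nonneg_right hA'le (by linarith)
    have e : (1 + κ * (u P / b * ∏ j ∈ Q, xf j - 1)) * w =
        (1 + κ * (u P / b * (∏ j ∈ Q, xf j) * w - 1)) + (1 - κ) * (w - 1) := by ring
    linarith
  -- g-budget ⟹ GQ · cf r ≤ V/a₀
  have hgbud : cf P * (∏ j ∈ Q, cf j) * cf r ≤ V / a₀ := by
    simp only [hcf]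
    rw [prod_div_distrib, prod_const, div_mul_div_comm, div_mul_div_comm,
      div_le_div_iff₀ (mul_pos (mul_pos ha₀ (pow_pos ha₀ _)) ha₀) ha₀]
    calc ((1 - s) * m P + s * vv P) * (∏ j ∈ Q, ((1 - s) * m j + s * vv j)) * ((1 - s) * m r + s * vv r) * a₀
        = ((1 - s) * m r + s * vv r) * (((1 - s) * m P + s * vv P) * ∏ j ∈ Q, ((1 - s) * m j + s * vv j)) * a₀ := by
          ring
      _ ≤ a₀ ^ (Q.card + 1) * V * a₀ := mul_le_mul_of_nonneg_right hpg ha₀.le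
      _ = V * (a₀ * a₀ ^ Q.card * a₀) := by ring
  have hgbud' : cf P * (∏ j ∈ Q, cf j) * (lam * w + μ * z) ≤ V / a₀ := by rw [← hcr]; exact hgbud
  -- vv-budget ⟹ γ_D z_P z ≤ V/a₀
  have hzbud : (lam * D + μ) * (vv P / β) * z ≤ V / a₀ := by
    rw [prod_congr rfl fun j hj => (hpack j hj).1, prod_const] at hpv
    have h1 : vv r * vv P ≤ β * V := by
      have h2 : vv r * vv P * β ^ Q.card ≤ β * V * β ^ Q.card := by
        have e1 : vv r * vv P * β ^ Q.card = vv r * (vv P * β ^ Q.card) := by ring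
        have e2 : β * V * β ^ Q.card = β ^ (Q.card + 1) * V := by ring
        rw [e1, e2]; exact hpv
      exact le_of_mul_le_mul_right h2 (pow_pos hβ _)
    have e3 : β / a₀ * (vv P / β) * (vv r / β) = (vv r * vv P) / (a₀ * β) := by
      field_simp
    rw [hγD, hzdef, e3, div_le_div_iff₀ (mul_pos ha₀ hβ) ha₀]
    calc vv r * vv P * a₀ ≤ β * V * a₀ := mul_le_mul_of_nonneg_right h1 ha₀.le
      _ = V * (a₀ * β) := by ring
  -- STEP B: the last petal (★ᵣ)
  have hgz1 : 1 ≤ (lam * D + μ) * (vv P / β) := one_le_mul_of_one_le_of_one_le hγD1 hz1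
  have hIle : 1 / A₀ * μ ≤ (lam * D + μ) * (vv P / β) := by
    rw [mul_comm, hI]
    calc (1 - κ) * (lam * D + μ) ≤ 1 * (lam * D + μ) := mul_le_mul_of_nonneg_right (by linarith) hγD0.le
      _ = lam * D + μ := one_mul _
      _ ≤ (lam * D + μ) * (vv P / β) := le_mul_of_one_le_right hγD0.le hz1
  have hstar : A' * (lam * w + μ * z) + cf P * (∏ j ∈ Q, cf j) * (1 + κ * (w - 1)) ≤ 1 / A₀ + V / a₀ := by
    refine star_r_of_hcr hμ0 hlμ hκ0 hκ1 hw hwz hgz1 hA'abar hA'a hA'w hαγr hgbud' hzbud hIle ?_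
    intro hrelG hrelA
    rcases hdisj with hleft | ⟨hA'eq, -⟩
    · exact absurd hrelA (not_lt.2 hleft)
    · have hGQeq : cf P * ∏ j ∈ Q, cf j = (lam * (m P / b) + μ * (vv P / β)) * packG lam Q ξ := by
        rw [hpackG, hγP]
      have hA'eq2 : A' = packG lam Q ξ * (1 + κ * (u P / b - 1)) -
          cf P * (∏ j ∈ Q, cf j) * packS κ lam Q ξ := by
        rw [hA'eq, hpackS, mul_sub, hpackG]
        congr 1
        rw [mul_comm (cf P) _, mul_assoc, mul_div_cancel₀ _ hγP0.ne']
      exact hcr_of_hc hκ0 hκl hl1 hμ hD hK0 habar hI Q hξ0 hξD hz1 hw1 hwx hwD hw hbud hGQeq hA'eq2 hrelG hrelA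
  -- the last coefficientwise step
  have hne : (insert P Q).Nonempty := insert_nonempty P Q
  have hfull : CoefDom (prodPoly (insert r (insert P Q)) (fun j => 1 + κ * (xf j - 1)) cf)
      ((C 1 * X + C 1) ^ ((insert r (insert P Q)).card - 1) * (C (1 / A₀) * X + C (V / a₀))) := by
    refine coefDom_prodPoly_insert hrt hne zero_le_one zero_le_one (by rw [har]; exact hαr0) hcr0 hdomPQ ?_ ?_ ?_
    · rw [har, one_mul]; exact hA'a
    · rw [one_mul]; exact hgbud
    · rw [har, hcr, one_mul, one_mul]; linarith
  -- STEP C: back to `DomOn`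
  refine domOn_of_normalised hA₀ ha₀ ⟨r, hrr⟩ ?_
  have e1 : (fun j => (s + (1 - s) * u j) / A₀) = fun j => 1 + κ * (xf j - 1) := funext hα
  rw [e1]
  exact hfull

end LinkedCurrency

end SafeCalc

end Summit.CriticalPhenomena.PercolationContinuityZ3.Theorems.SunflowerPartition
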